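import Summits.AtomisticToContinuum.FouriersLaw.Theorems.BondHeatUncertaintySubdiffusiveBondHeatJunctionRatioWeakResponse

/-!
# [BI] — cutoff commutators for the bracket extension («CutoffCommutators», 24c)

Third file of the `[BI] ⟸ [EXT] ∧ [LINK]` chain for the residual
`Summit.AtomisticToContinuum.FouriersLaw.Theses.BondHeatUncertainty.BoundedResponse`
(item `stmt-AtomisticToContinuum-11071`), door
`boundedResponse_of_bracket_of_peeled_of_escapeInfZero_of_subOhmicBootstrap′`, leaf [BI] =
`FirstBondBracket` (19b).  The step [EXT] (file 24d) extends the two weak identities behind [BI]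
(the tap-score identity of `IsTapScoreAt` and the weak stationarity of 24a) from `C_c^∞` test
functions to the tempered smooth pair `(Ψ, G)` of the bracket (C3) by testing with energy cutoffs
`χ_R Ψ`, `χ_R G`, `χ_R = χ(H/R)`.  This file supplies the pointwise cutoff calculus it needs:

* §A: a squeeze lemma (`|u − v| ≤ K/R`, `v → l ⇒ u → l`) and `C_c × L²(μ_T) ⊂ L¹(μ_T)`;
* §B: `∂_{p_b}χ_R = χ′(H/R) p_b / R`, the adjoint commutator
  `A_b(χ_R φ) = χ_R A_b φ − φ χ′(H/R) p_b / R`, and the generator commutator bound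
  `|L(χ_R F) − χ_R LF| ≤ (|F|(γ(TS₂+S₁)(p_0²+p_{N−1}²) + 2γTS₁) + 2γTS₁(|p_0∂_{p_0}F| + |p_{N−1}∂_{p_{N−1}}F|))/R`
  (`R ≥ 1`; Leibniz rule 22a, `|Lχ_R| = O(1/R)` of the cutoff-energy file).

No new definitions.  Written for the decomposition cell `decomp-a2c` (lens 1, g66).
-/

noncomputable section

open MeasureTheory Filter Topology Set
open scoped NNReal ENNReal ContDiff

namespace Summit.AtomisticToContinuum.FouriersLaw.Theorems.SubdiffusiveBondHeat.EscapeGrading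

open Literature.MathematicalPhysics.KineticTheory.HeatConduction
open Literature.Probability.Process Literature.MathematicalPhysics.KineticTheory OscillatorChain
open Summit.AtomisticToContinuum.FouriersLaw.Theorems.SubdiffusiveBondHeat.JunctionDefectGrading

variable {N : ℕ} {ω₂ lam β γ : ℝ}

/-! ## A. Elementary helpers -/

/-- If `v R → l` and `|u R − v R| ≤ K/R` for `R ≥ 1`, then `u R → l` (`R → ∞`). [folklore] -/
theorem tendsto_of_abs_sub_le_div {u v : ℝ → ℝ} {l K : ℝ} (hv : Tendsto v atTop (𝓝 l))
    (h : ∀ R : ℝ, 1 ≤ R → |u R - v R| ≤ K / R) : Tendsto u atTop (𝓝 l) := by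
  have hK : Tendsto (fun R : ℝ => K / R) atTop (𝓝 0) := tendsto_const_nhds.div_atTop tendsto_id
  have hd : Tendsto (fun R => u R - v R) atTop (𝓝 0) := by
    refine squeeze_zero_norm' ?_ hK
    filter_upwards [eventually_ge_atTop (1 : ℝ)] with R hR
    rw [Real.norm_eq_abs]
    exact h R hR
  have h2 := hd.add hv
  simp only [zero_add, sub_add_cancel] at h2
  exact h2

/-- A continuous compactly supported factor times an `L²(μ_T)` density is integrable (`T > 0`).
[folklore] -/
theorem integrable_mul_of_hasCompactSupport (hω : 0 < ω₂) (hl : 0 ≤ lam) (hβ : 0 ≤ β) {T : ℝ}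
    (hT : 0 < T) {f h : PhaseSpace N → ℝ} (hf : Continuous f) (hfc : HasCompactSupport f)
    (hh : MemLp h 2 ((pinnedChain ω₂ lam β γ).gibbsMeasure N T)) :
    Integrable (fun x => f x * h x) ((pinnedChain ω₂ lam β γ).gibbsMeasure N T) := by
  haveI := pinnedChain_isProbabilityMeasure_gibbsMeasure hω hl hβ γ N hT
  have hf2 : MemLp f 2 ((pinnedChain ω₂ lam β γ).gibbsMeasure N T) :=
    (hf.memLp_top_of_hasCompactSupport hfc _).mono_exponent le_top
  exact MemLp.integrable_mul hf2 hh

/-! ## B. Cutoff calculus: `∂_p χ_R`, the adjoint and generator commutators, the `O(1/R)` bound -/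

/-- `∂_{p_b} χ_R = χ′(H/R)/R · p_b` for the energy cutoff `χ_R = χ(H/R)`. [calculus] -/
theorem partialP_cutoff (R : ℝ) (b : Fin N) (x : PhaseSpace N) :
    partialP b (fun y => smoothCutoff ((pinnedChain ω₂ lam β γ).hamiltonian N y / R)) x =
      deriv smoothCutoff ((pinnedChain ω₂ lam β γ).hamiltonian N x / R) / R * x.2 b :=
  congrFun ((pinnedChain ω₂ lam β γ).partialP_comp_hamiltonian (hasDerivAt_cutoffProfile R) N b) x

/-- **Adjoint commutator.** `A_b(χ_R φ) = χ_R A_b φ − φ · χ′(H/R) p_b / R` (written out). [calculus] -/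
theorem adjointP_cutoff_mul (T R : ℝ) (b : Fin N) {φ : PhaseSpace N → ℝ} (hφ : Differentiable ℝ φ)
    (x : PhaseSpace N) :
    x.2 b / T * (smoothCutoff ((pinnedChain ω₂ lam β γ).hamiltonian N x / R) * φ x)
        - partialP b (fun y => smoothCutoff ((pinnedChain ω₂ lam β γ).hamiltonian N y / R) * φ y) x =
      smoothCutoff ((pinnedChain ω₂ lam β γ).hamiltonian N x / R) * (x.2 b / T * φ x - partialP b φ x)
        - φ x * (deriv smoothCutoff ((pinnedChain ω₂ lam β γ).hamiltonian N x / R) / R * x.2 b) := by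
  have hχd : Differentiable ℝ fun y : PhaseSpace N =>
      smoothCutoff ((pinnedChain ω₂ lam β γ).hamiltonian N y / R) :=
    (pinnedChain_contDiff_cutoff N γ R).differentiable (by simp)
  have e : partialP b (fun y => smoothCutoff ((pinnedChain ω₂ lam β γ).hamiltonian N y / R) * φ y) x =
      smoothCutoff ((pinnedChain ω₂ lam β γ).hamiltonian N x / R) * partialP b φ x
        + φ x * partialP b (fun y => smoothCutoff ((pinnedChain ω₂ lam β γ).hamiltonian N y / R)) x :=
    partialP_mul hχd hφ b x
  rw [e, partialP_cutoff]
  ring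

/-- **Generator commutator bound.** For `F ∈ C²` and `R ≥ 1` (`γ, T ≥ 0`, `|χ′| ≤ S₁`, `|χ″| ≤ S₂`):
`|L(χ_R F) − χ_R LF| ≤ (|F|(γ(TS₂+S₁)(p_0²+p_{N−1}²) + 2γTS₁) + 2γTS₁(|p_0 ∂_{p_0}F| + |p_{N−1} ∂_{p_{N−1}}F|))/R`
(Leibniz rule 22a `generator_mul_fun`, `|Lχ_R| = O(1/R)` from the cutoff-energy file, and
`∂_{p_i}χ_R = χ′ p_i/R`). [calculus] -/
theorem abs_generator_cutoff_mul_sub_le (hN : 0 < N) (hγ : 0 ≤ γ) {T : ℝ} (hT : 0 ≤ T) {S₁ S₂ : ℝ}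
    (hS₁ : ∀ v, |deriv smoothCutoff v| ≤ S₁) (hS₂ : ∀ v, |deriv (deriv smoothCutoff) v| ≤ S₂)
    {F : PhaseSpace N → ℝ} (hF : ContDiff ℝ 2 F) {R : ℝ} (hR : 1 ≤ R) (x : PhaseSpace N) :
    |(pinnedChain ω₂ lam β γ).generator N T T
          (fun y => smoothCutoff ((pinnedChain ω₂ lam β γ).hamiltonian N y / R) * F y) x
        - smoothCutoff ((pinnedChain ω₂ lam β γ).hamiltonian N x / R) *
          (pinnedChain ω₂ lam β γ).generator N T T F x| ≤
      (|F x| * (γ * (T * S₂ + S₁) * (x.2 ⟨0, hN⟩ ^ 2 + x.2 ⟨N - 1, by omega⟩ ^ 2) + 2 * γ * T * S₁)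
        + 2 * γ * T * S₁ * (|x.2 ⟨0, hN⟩ * partialP ⟨0, hN⟩ F x|
          + |x.2 ⟨N - 1, by omega⟩ * partialP ⟨N - 1, by omega⟩ F x|)) / R := by
  have htop1 : ((⊤ : ℕ∞) : WithTop ℕ∞) + 1 ≤ ((⊤ : ℕ∞) : WithTop ℕ∞) := by exact_mod_cast le_top
  have htop2 : ((⊤ : ℕ∞) : WithTop ℕ∞) + 2 ≤ ((⊤ : ℕ∞) : WithTop ℕ∞) :=
    calc ((⊤ : ℕ∞) : WithTop ℕ∞) + 2 = (⊤ : ℕ∞) + 1 + 1 := by rw [add_assoc, one_add_one_eq_two]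
      _ ≤ (⊤ : ℕ∞) + 1 := add_le_add_right htop1 1
      _ ≤ (⊤ : ℕ∞) := htop1
  have h2top : (2 : WithTop ℕ∞) ≤ ((⊤ : ℕ∞) : WithTop ℕ∞) := le_trans le_add_self htop2
  have hχ2 : ContDiff ℝ 2 fun y : PhaseSpace N =>
      smoothCutoff ((pinnedChain ω₂ lam β γ).hamiltonian N y / R) :=
    (pinnedChain_contDiff_cutoff N γ R).of_le h2top
  have hR0 : 0 < R := by linarith
  have hγP : (pinnedChain ω₂ lam β γ).γ = γ := rfl
  have hsum : ∑ i : Fin N, ((if i.val = 0 then T else 0) + (if i.val = N - 1 then T else 0)) *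
      (partialP i (fun y => smoothCutoff ((pinnedChain ω₂ lam β γ).hamiltonian N y / R)) x *
        partialP i F x) =
      T * (deriv smoothCutoff ((pinnedChain ω₂ lam β γ).hamiltonian N x / R) / R * x.2 ⟨0, hN⟩ *
          partialP ⟨0, hN⟩ F x)
        + T * (deriv smoothCutoff ((pinnedChain ω₂ lam β γ).hamiltonian N x / R) / R *
          x.2 ⟨N - 1, by omega⟩ * partialP ⟨N - 1, by omega⟩ F x) := by
    have e : ∀ i : Fin N, ((if i.val = 0 then T else 0) + (if i.val = N - 1 then T else 0)) *
        (partialP i (fun y => smoothCutoff ((pinnedChain ω₂ lam β γ).hamiltonian N y / R)) x *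
          partialP i F x) =
        (if i.val = 0 then T * (deriv smoothCutoff ((pinnedChain ω₂ lam β γ).hamiltonian N x / R) / R *
            x.2 i * partialP i F x) else 0)
          + (if i.val = N - 1 then T * (deriv smoothCutoff ((pinnedChain ω₂ lam β γ).hamiltonian N x / R)
            / R * x.2 i * partialP i F x) else 0) := by
      intro i
      rw [partialP_cutoff]
      split_ifs <;> ring
    rw [Finset.sum_congr rfl fun i _ => e i]
    exact sum_bath_tilt_eq hN T T fun i =>
      deriv smoothCutoff ((pinnedChain ω₂ lam β γ).hamiltonian N x / R) / R * x.2 i * partialP i F x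
  rw [generator_mul_fun (pinnedChain ω₂ lam β γ) T T hχ2 hF x, hγP, hsum]
  have hLχ := pinnedChain_abs_generator_cutoff_le N hN hγ hT hS₁ hS₂ hR x
    (ω₂ := ω₂) (lam := lam) (β := β)
  have hD : |deriv smoothCutoff ((pinnedChain ω₂ lam β γ).hamiltonian N x / R)| ≤ S₁ := hS₁ _
  have hS0 : 0 ≤ S₁ := (abs_nonneg _).trans hD
  have h1 : |F x * (pinnedChain ω₂ lam β γ).generator N T T
        (fun y => smoothCutoff ((pinnedChain ω₂ lam β γ).hamiltonian N y / R)) x| ≤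
      |F x| * ((γ * (T * S₂ + S₁) * (x.2 ⟨0, hN⟩ ^ 2 + x.2 ⟨N - 1, by omega⟩ ^ 2) + 2 * γ * T * S₁) / R) := by
    rw [abs_mul]
    exact mul_le_mul_of_nonneg_left hLχ (abs_nonneg _)
  have h2 : |2 * γ * T * (deriv smoothCutoff ((pinnedChain ω₂ lam β γ).hamiltonian N x / R) / R) *
        (x.2 ⟨0, hN⟩ * partialP ⟨0, hN⟩ F x + x.2 ⟨N - 1, by omega⟩ * partialP ⟨N - 1, by omega⟩ F x)| ≤
      2 * γ * T * (S₁ / R) * (|x.2 ⟨0, hN⟩ * partialP ⟨0, hN⟩ F x|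
        + |x.2 ⟨N - 1, by omega⟩ * partialP ⟨N - 1, by omega⟩ F x|) := by
    rw [abs_mul]
    have h3 : |2 * γ * T * (deriv smoothCutoff ((pinnedChain ω₂ lam β γ).hamiltonian N x / R) / R)| ≤
        2 * γ * T * (S₁ / R) := by
      rw [abs_mul, abs_div, abs_of_pos hR0, abs_of_nonneg (by positivity : (0 : ℝ) ≤ 2 * γ * T)]
      exact mul_le_mul_of_nonneg_left (div_le_div_of_nonneg_right hD hR0.le) (by positivity)
    exact mul_le_mul h3 (abs_add_le _ _) (abs_nonneg _) (by positivity)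
  calc |smoothCutoff ((pinnedChain ω₂ lam β γ).hamiltonian N x / R) *
            (pinnedChain ω₂ lam β γ).generator N T T F x
          + F x * (pinnedChain ω₂ lam β γ).generator N T T
            (fun y => smoothCutoff ((pinnedChain ω₂ lam β γ).hamiltonian N y / R)) x
          + 2 * γ * (T * (deriv smoothCutoff ((pinnedChain ω₂ lam β γ).hamiltonian N x / R) / R *
              x.2 ⟨0, hN⟩ * partialP ⟨0, hN⟩ F x)
            + T * (deriv smoothCutoff ((pinnedChain ω₂ lam β γ).hamiltonian N x / R) / R *
              x.2 ⟨N - 1, by omega⟩ * partialP ⟨N - 1, by omega⟩ F x))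
          - smoothCutoff ((pinnedChain ω₂ lam β γ).hamiltonian N x / R) *
            (pinnedChain ω₂ lam β γ).generator N T T F x|
        = |F x * (pinnedChain ω₂ lam β γ).generator N T T
              (fun y => smoothCutoff ((pinnedChain ω₂ lam β γ).hamiltonian N y / R)) x
            + 2 * γ * T * (deriv smoothCutoff ((pinnedChain ω₂ lam β γ).hamiltonian N x / R) / R) *
              (x.2 ⟨0, hN⟩ * partialP ⟨0, hN⟩ F x
                + x.2 ⟨N - 1, by omega⟩ * partialP ⟨N - 1, by omega⟩ F x)| := by
          congr 1; ring
    _ ≤ _ := abs_add_le _ _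
    _ ≤ |F x| * ((γ * (T * S₂ + S₁) * (x.2 ⟨0, hN⟩ ^ 2 + x.2 ⟨N - 1, by omega⟩ ^ 2) + 2 * γ * T * S₁) / R)
          + 2 * γ * T * (S₁ / R) * (|x.2 ⟨0, hN⟩ * partialP ⟨0, hN⟩ F x|
            + |x.2 ⟨N - 1, by omega⟩ * partialP ⟨N - 1, by omega⟩ F x|) := add_le_add h1 h2
    _ = _ := by ring

end Summit.AtomisticToContinuum.FouriersLaw.Theorems.SubdiffusiveBondHeat.EscapeGrading

end
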